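import Literature.AlgebraicGeometry.Limits.LimitSectionsDescent
import Literature.AlgebraicGeometry.Modules.FrameTransition
import Literature.AlgebraicGeometry.Modules.UnitCocycle
import HarnessLib

/-!
# Limits of schemes: the transition cocycle of a vector bundle on the limit descends to a stage
# (steps towards The Stacks Project, Lemma 32.10.3 (1), Tag 0B8W)

Topic: `Literature/AlgebraicGeometry/Limits`. Let `c.pt = lim_i D i` be the limit of a cofiltered
diagram of quasi-compact quasi-separated schemes with affine transition maps, projections `π_i`,
and let `E` be a finite locally free `𝒪_{c.pt}`-module. This file carries the TRANSITION DATA of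
`E` down to a stage, in three steps (the fourth — gluing and comparison — is
`Limits/FiniteLocallyFreeDescent`):

* `exists_frames` — `E` is trivialised by frames `e_a : 𝒪^{J_a} ≅ E|_{U_a}` on finitely many
  opens `U_a = π_i⁻¹ V_a` covering the limit, `V_a` quasi-compact opens of ONE stage `D i`
  (Mathlib: `isBasis_preimage_isAffineOpen`, `Scheme.compactSpace_of_isLimit`);
* `exists_stage_transition` — the transition matrices `T(e_a, e_b)` over `U_a ∩ U_b`
  (`Modules/FrameTransition`) are `π_j^♯` of matrices `T_{ab}` over `(D f)⁻¹V_a ∩ (D f)⁻¹V_b` on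
  some stage `D j` (`Limits/LimitSectionsDescent.exists_appLE_π_eq_of_finite`);
* `exists_stage_cocycle` — on a deeper stage `D k` the pulled-back matrices satisfy
  `T_{aa} = 1` and the cocycle identity `T_{ab} T_{bd} = T_{ad}` on triple overlaps, and the opens
  cover `D k` (the identities hold after `π_j^♯` — `transition_self`, `transition_mul` — hence at
  some stage, `Limits/LimitSectionsDescent.exists_app_map_eq_map_of_finite`; the covering by
  Mathlib `exists_map_eq_top`).

All opens are kept in the distributed form `(D f)⁻¹ V_a ⊓ (D f)⁻¹ V_b` so that successive
statements match verbatim. Everything is proved; no named facts.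

## Edition 2 (2026-08-29)

Docstring-only re-filing (watcher-trigger edition, cell `hodgecm-mathlib`, director ruling s149):
the declarations below are byte-identical to edition 1 (2026-08-21); the file is re-submitted so
that the hub build lane produces this module's `.olean`, which the downstream importers
`Limits/FiniteLocallyFreeDescent` (this topic) and, through it, the 2026-08-29 consumers
`Limits/FiniteLocallyFreeSubalgebraDescent` → `AbelianSchemes/RigidifiedLineBundleLimitDescentStage`
(M13 node N0 (0d), G4) need.

## References

* The Stacks Project, Lemma 32.10.3 (Tag 0B8W) (1); Lemma 32.4.7 (Tag 01Z0). [StacksProject]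
* U. Görtz, T. Wedhorn, *Algebraic Geometry I*, 2nd ed. (2020), Thm. 10.60, Exercise 10.33.
  [GortzWedhorn2020]
* R. Hartshorne, *Algebraic Geometry* (1977), II Ex. 5.18 (transition matrices). [Hartshorne1977]
-/

universe u

open CategoryTheory CategoryTheory.Limits AlgebraicGeometry TopologicalSpace Opposite
open Literature.AlgebraicGeometry.Motives Literature.AlgebraicGeometry.Modules

namespace Literature.AlgebraicGeometry.Limits

set_option backward.isDefEq.respectTransparency false

variable {I : Type u} [Category.{u} I] [IsCofiltered I] (D : I ⥤ Scheme.{u})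
  (c : Cone D) (hc : IsLimit c) [∀ {i j : I} (f : i ⟶ j), IsAffineHom (D.map f)]
  [∀ i, CompactSpace (D.obj i)] [∀ i, QuasiSeparatedSpace (D.obj i)]

namespace FiniteLocallyFreeDescent

/-! ### Plumbing: matrices of sections under `appLE` and restriction -/

omit [IsCofiltered I] [∀ {i j : I} (f : i ⟶ j), IsAffineHom (D.map f)]
  [∀ i, CompactSpace (D.obj i)] [∀ i, QuasiSeparatedSpace (D.obj i)] in
/-- An `app`-equality gives the `appLE`-equality over any smaller open. [folklore] -/
private lemma appLE_eq_of_app_eq {X Y : Scheme.{u}} (f : X ⟶ Y) {O : Y.Opens} {O' : X.Opens}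
    (e : O' ≤ f ⁻¹ᵁ O) {s s' : Γ(Y, O)} (h : f.app O s = f.app O s') :
    f.appLE O O' e s = f.appLE O O' e s' := by
  change (f.app O ≫ X.presheaf.map (homOfLE e).op) s = (f.app O ≫ X.presheaf.map (homOfLE e).op) s'
  rw [CategoryTheory.comp_apply, CategoryTheory.comp_apply, h]

omit [IsCofiltered I] [∀ {i j : I} (f : i ⟶ j), IsAffineHom (D.map f)]
  [∀ i, CompactSpace (D.obj i)] [∀ i, QuasiSeparatedSpace (D.obj i)] in
/-- `appLE` after restricting a matrix is one `appLE`. [folklore] -/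
private lemma map_secRes_map_appLE {X Y : Scheme.{u}} (f : X ⟶ Y) {W W' : Y.Opens} {O : X.Opens}
    (h : W' ≤ W) (e' : O ≤ f ⁻¹ᵁ W') {m n : Type*} (M : Matrix m n Γ(Y, W)) :
    (M.map (secRes Y h)).map (f.appLE W' O e').hom =
      M.map (f.appLE W O (e'.trans ((Opens.map f.base).map (homOfLE h)).le)).hom := by
  rw [Matrix.map_map]
  congr 1
  funext s
  change (Y.presheaf.map (homOfLE h).op ≫ f.appLE W' O e') s = _
  rw [Scheme.Hom.map_appLE]

omit [IsCofiltered I] [∀ {i j : I} (f : i ⟶ j), IsAffineHom (D.map f)]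
  [∀ i, CompactSpace (D.obj i)] [∀ i, QuasiSeparatedSpace (D.obj i)] in
/-- Restricting a matrix after `appLE` is one `appLE`. [folklore] -/
private lemma map_appLE_map_secRes {X Y : Scheme.{u}} (f : X ⟶ Y) {W : Y.Opens} {O O' : X.Opens}
    (h' : O' ≤ O) (e : O ≤ f ⁻¹ᵁ W) {m n : Type*} (M : Matrix m n Γ(Y, W)) :
    (M.map (f.appLE W O e).hom).map (secRes X h') = M.map (f.appLE W O' (h'.trans e)).hom := by
  rw [Matrix.map_map]
  congr 1
  funext s
  change (f.appLE W O e ≫ X.presheaf.map (homOfLE h').op) s = _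
  rw [Scheme.Hom.appLE_map]

/-! ### Step 1: frames on finitely many preimages of quasi-compact opens of one stage -/

include hc in
omit [∀ i, QuasiSeparatedSpace (D.obj i)] in
/-- **Charts at one stage.** A finite locally free module `E` on the limit is trivialised on
finitely many opens `U_a = π_i⁻¹ V_a` covering the limit, the `V_a` quasi-compact opens of ONE
stage `D i` (frames exist locally; the `π_i⁻¹ V`, `V` affine, form a basis of the limit — Mathlib
`isBasis_preimage_isAffineOpen`; the limit is quasi-compact — Mathlib
`Scheme.compactSpace_of_isLimit`; finitely many stages are dominated by one).
[cite: StacksProject, Tag 0B8W (Lemma 32.10.3 (1))] -/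
theorem exists_frames {E : c.pt.Modules} (hE : IsFiniteLocallyFree E) :
    ∃ (i : I) (ι : Type u) (_ : Fintype ι) (V : ι → (D.obj i).Opens) (J : ι → Type u)
      (_ : ∀ a, Fintype (J a)) (U : ι → c.pt.Opens)
      (_ : ∀ a, SheafOfModules.free (J a) ≅ E.over (U a)),
      (∀ a, c.π.app i ⁻¹ᵁ V a = U a) ∧ (∀ a, IsCompact (V a : Set (D.obj i))) ∧ (⨆ a, U a) = ⊤ := by
  classical
  haveI := Scheme.compactSpace_of_isLimit D c hc
  have hx : ∀ x : c.pt, ∃ (i : I) (V : (D.obj i).Opens), IsAffineOpen V ∧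
      x ∈ c.π.app i ⁻¹ᵁ V ∧ ∃ (J : Type u), Finite J ∧
        Nonempty (SheafOfModules.free J ≅ E.over (c.π.app i ⁻¹ᵁ V)) := by
    intro x
    obtain ⟨U, hxU, J, hJ, ⟨e⟩⟩ := hE x
    obtain ⟨_, ⟨W, ⟨i, V, hV, rfl⟩, rfl⟩, hxW, hWU⟩ :=
      (isBasis_preimage_isAffineOpen D c hc).exists_subset_of_mem_open
        (SetLike.mem_coe.mpr hxU) U.2
    exact ⟨i, V, hV, hxW, J, hJ,
      ⟨SheafOfModules.restrictTrivialisation (R := c.pt.ringCatSheaf)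
        (homOfLE (SetLike.coe_subset_coe.mp hWU)) e⟩⟩
  choose i V hV hxV J hJ he using hx
  -- the opens `π_{i x}⁻¹ V_x` of the limit
  let O : c.pt → c.pt.Opens := fun x => c.π.app (i x) ⁻¹ᵁ V x
  obtain ⟨t, ht⟩ := CompactSpace.elim_nhds_subcover (fun x => (O x : Set c.pt))
    (fun x => (O x).2.mem_nhds (hxV x))
  obtain ⟨j, hj⟩ := IsCofiltered.inf_objs_exists (t.image i)
  have f : ∀ x : ↥t, j ⟶ i x := fun x => (hj (Finset.mem_image_of_mem i x.2)).some
  have hpre : ∀ x : ↥t, c.π.app j ⁻¹ᵁ (D.map (f x) ⁻¹ᵁ V x) = O x := fun x => by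
    change (c.π.app j ⁻¹ᵁ (D.map (f x) ⁻¹ᵁ V x) : c.pt.Opens) = c.π.app (i x) ⁻¹ᵁ V x
    rw [← Scheme.Hom.comp_preimage, c.w]
  refine ⟨j, ↥t, inferInstance, fun x => D.map (f x) ⁻¹ᵁ V x, fun x => J x,
    fun x => @Fintype.ofFinite _ (hJ x), fun x => O x, fun x => (he x).some, hpre,
    fun x => (D.map (f x)).isCompact_preimage (hV x).isCompact, ?_⟩
  rw [eq_top_iff]
  rintro y -
  obtain ⟨x, hxt, hy⟩ := Set.mem_iUnion₂.mp (ht.ge (Set.mem_univ y))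
  exact Opens.mem_iSup.mpr ⟨⟨x, hxt⟩, hy⟩

/-! ### Step 2: the transition matrices descend to one stage -/

variable {E : c.pt.Modules} {ι : Type u} [Fintype ι] {J : ι → Type u} [∀ a, Fintype (J a)]
  [∀ a, DecidableEq (J a)] {U : ι → c.pt.Opens}
  (e : ∀ a, SheafOfModules.free (J a) ≅ E.over (U a))

include hc in
omit [∀ a, DecidableEq (J a)] [∀ i, CompactSpace (D.obj i)] in
/-- **The transition matrices come from a stage.** If the frames `e_a` of `E` live on
`U_a = π_i⁻¹ V_a` (`V_a` quasi-compact opens of `D i`), their transition matrices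
`T(e_a, e_b)` over `U_a ∩ U_b` are pulled back from matrices over `(D f)⁻¹ V_a ∩ (D f)⁻¹ V_b` on
some stage `D j` (`Limits/LimitSectionsDescent`, finitely many entries at once).
[cite: StacksProject, Tag 0B8W (Lemma 32.10.3 (1))] -/
theorem exists_stage_transition {i : I} (V : ι → (D.obj i).Opens)
    (hVc : ∀ a, IsCompact (V a : Set (D.obj i))) (hUV : ∀ a, c.π.app i ⁻¹ᵁ V a = U a) :
    ∃ (j : I) (f : j ⟶ i)
      (T : ∀ a b, Matrix (J a) (J b) Γ(D.obj j, D.map f ⁻¹ᵁ V a ⊓ D.map f ⁻¹ᵁ V b))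
      (hle : ∀ a b, U a ⊓ U b ≤ c.π.app j ⁻¹ᵁ (D.map f ⁻¹ᵁ V a ⊓ D.map f ⁻¹ᵁ V b)),
      ∀ a b, (T a b).map ((c.π.app j).appLE (D.map f ⁻¹ᵁ V a ⊓ D.map f ⁻¹ᵁ V b) (U a ⊓ U b)
          (hle a b)).hom =
        transition (e a) (e b) (Opens.infLELeft (U a) (U b)) (Opens.infLERight (U a) (U b)) := by
  have hU' : ∀ p : ι × ι, c.π.app i ⁻¹ᵁ (V p.1 ⊓ V p.2) = U p.1 ⊓ U p.2 := fun p => by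
    rw [Scheme.Hom.preimage_inf, hUV, hUV]
  obtain ⟨j, f, t, ht⟩ := exists_appLE_π_eq_of_finite D c hc
    (α := Σ p : ι × ι, J p.1 × J p.2) (fun x => V x.1.1 ⊓ V x.1.2)
    (fun x => (hVc x.1.1).inter_of_isOpen (hVc x.1.2) (V x.1.1).2 (V x.1.2).2)
    (fun x => U x.1.1 ⊓ U x.1.2) (fun x => hU' x.1)
    (fun x => transition (e x.1.1) (e x.1.2) (Opens.infLELeft _ _) (Opens.infLERight _ _)
      x.2.1 x.2.2)
  have hle : ∀ a b, U a ⊓ U b ≤ c.π.app j ⁻¹ᵁ (D.map f ⁻¹ᵁ V a ⊓ D.map f ⁻¹ᵁ V b) :=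
    fun a b => by
    rw [← hU' (a, b), ← Scheme.Hom.preimage_inf]
    change (c.π.app i ⁻¹ᵁ (V a ⊓ V b) : c.pt.Opens) ≤ c.π.app j ⁻¹ᵁ (D.map f ⁻¹ᵁ (V a ⊓ V b))
    rw [← Scheme.Hom.comp_preimage, c.w]
  refine ⟨j, f, fun a b => Matrix.of fun x y => t ⟨(a, b), (x, y)⟩, hle, fun a b => ?_⟩
  ext x y
  exact ht ⟨(a, b), (x, y)⟩

/-! ### Step 3: the cocycle identities and the covering descend -/

omit [IsCofiltered I] [∀ {i j : I} (f : i ⟶ j), IsAffineHom (D.map f)]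
  [∀ i, CompactSpace (D.obj i)] [∀ i, QuasiSeparatedSpace (D.obj i)] in
/-- Equalities of sections at a stage persist at all deeper stages. [folklore] -/
private lemma app_eq_app_of_comp {i j k : I} (f : j ⟶ i) (g : k ⟶ j) {W : (D.obj i).Opens}
    {s s' : Γ(D.obj i, W)} (h : (D.map f).app W s = (D.map f).app W s') :
    (D.map (g ≫ f)).app W s = (D.map (g ≫ f)).app W s' := by
  rw [Scheme.Hom.congr_app (D.map_comp g f) W, Scheme.Hom.comp_app]
  change (D.obj k).presheaf.map _ ((D.map g).app _ ((D.map f).app W s)) =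
    (D.obj k).presheaf.map _ ((D.map g).app _ ((D.map f).app W s'))
  rw [h]

omit [IsCofiltered I] [∀ {i j : I} (f : i ⟶ j), IsAffineHom (D.map f)]
  [∀ i, CompactSpace (D.obj i)] [∀ i, QuasiSeparatedSpace (D.obj i)] in
/-- From an `appLE`-equality over an open EQUAL to the preimage to an `app`-equality.
[folklore] -/
private lemma app_eq_app_of_appLE {X Y : Scheme.{u}} (f : X ⟶ Y) {W : Y.Opens} {W' : X.Opens}
    (h : f ⁻¹ᵁ W = W') (e : W' ≤ f ⁻¹ᵁ W) {s s' : Γ(Y, W)}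
    (hs : f.appLE W W' e s = f.appLE W W' e s') : f.app W s = f.app W s' := by
  subst h
  rwa [Scheme.Hom.appLE_eq_app] at hs

include hc in
/-- **The cocycle identities and the covering hold at some stage.** In the situation of
`exists_stage_transition` (frames `e_a` on `U_a = π_i⁻¹ V_a` covering the limit, matrices `T_{ab}`
on the stage `D j` pulling back to the transition matrices), there is `g : k ⟶ j` such that on
`D k`, writing `W_a = (D g)⁻¹ (D f)⁻¹ V_a` and `G_{ab} = (D g)^♯ T_{ab}` over `W_a ∩ W_b`:
`G_{aa} = 1`, `G_{ab} G_{bd} = G_{ad}` on `W_a ∩ W_b ∩ W_d`, and the `W_a` cover `D k` (each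
identity holds after `π_j^♯` by the cocycle identities of transition matrices, hence at some stage:
`Limits/LimitSectionsDescent`; the covering by Mathlib `exists_map_eq_top`).
[cite: StacksProject, Tag 0B8W (Lemma 32.10.3 (1))] -/
theorem exists_stage_cocycle {i : I} (V : ι → (D.obj i).Opens)
    (hVc : ∀ a, IsCompact (V a : Set (D.obj i))) (hUV : ∀ a, c.π.app i ⁻¹ᵁ V a = U a)
    (hUtop : (⨆ a, U a) = ⊤) {j : I} (f : j ⟶ i)
    (T : ∀ a b, Matrix (J a) (J b) Γ(D.obj j, D.map f ⁻¹ᵁ V a ⊓ D.map f ⁻¹ᵁ V b))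
    (hle : ∀ a b, U a ⊓ U b ≤ c.π.app j ⁻¹ᵁ (D.map f ⁻¹ᵁ V a ⊓ D.map f ⁻¹ᵁ V b))
    (hT : ∀ a b, (T a b).map ((c.π.app j).appLE (D.map f ⁻¹ᵁ V a ⊓ D.map f ⁻¹ᵁ V b)
      (U a ⊓ U b) (hle a b)).hom =
      transition (e a) (e b) (Opens.infLELeft (U a) (U b)) (Opens.infLERight (U a) (U b))) :
    ∃ (k : I) (g : k ⟶ j)
      (hW : ∀ a b, D.map g ⁻¹ᵁ (D.map f ⁻¹ᵁ V a) ⊓ D.map g ⁻¹ᵁ (D.map f ⁻¹ᵁ V b) ≤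
        D.map g ⁻¹ᵁ (D.map f ⁻¹ᵁ V a ⊓ D.map f ⁻¹ᵁ V b)),
      (∀ a, (T a a).map ((D.map g).appLE (D.map f ⁻¹ᵁ V a ⊓ D.map f ⁻¹ᵁ V a)
        (D.map g ⁻¹ᵁ (D.map f ⁻¹ᵁ V a) ⊓ D.map g ⁻¹ᵁ (D.map f ⁻¹ᵁ V a)) (hW a a)).hom = 1) ∧
      (∀ a b d,
        ((T a b).map ((D.map g).appLE _ _ (hW a b)).hom).map (secRes (D.obj k)
            (inf_le_left : D.map g ⁻¹ᵁ (D.map f ⁻¹ᵁ V a) ⊓ D.map g ⁻¹ᵁ (D.map f ⁻¹ᵁ V b) ⊓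
              D.map g ⁻¹ᵁ (D.map f ⁻¹ᵁ V d) ≤ _)) *
          ((T b d).map ((D.map g).appLE _ _ (hW b d)).hom).map (secRes (D.obj k)
            (le_inf (inf_le_left.trans inf_le_right) inf_le_right :
              D.map g ⁻¹ᵁ (D.map f ⁻¹ᵁ V a) ⊓ D.map g ⁻¹ᵁ (D.map f ⁻¹ᵁ V b) ⊓
                D.map g ⁻¹ᵁ (D.map f ⁻¹ᵁ V d) ≤ _)) =
        ((T a d).map ((D.map g).appLE _ _ (hW a d)).hom).map (secRes (D.obj k)
            (le_inf (inf_le_left.trans inf_le_left) inf_le_right :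
              D.map g ⁻¹ᵁ (D.map f ⁻¹ᵁ V a) ⊓ D.map g ⁻¹ᵁ (D.map f ⁻¹ᵁ V b) ⊓
                D.map g ⁻¹ᵁ (D.map f ⁻¹ᵁ V d) ≤ _))) ∧
      (⨆ a, D.map g ⁻¹ᵁ (D.map f ⁻¹ᵁ V a)) = ⊤ := by
  -- abbreviations for the opens of the stage `D j`
  have hV2c : ∀ a b, IsCompact ((D.map f ⁻¹ᵁ V a ⊓ D.map f ⁻¹ᵁ V b : (D.obj j).Opens) :
      Set (D.obj j)) := fun a b =>
    ((D.map f).isCompact_preimage (hVc a)).inter_of_isOpen ((D.map f).isCompact_preimage (hVc b))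
      (D.map f ⁻¹ᵁ V a).2 (D.map f ⁻¹ᵁ V b).2
  have hUV' : ∀ a, c.π.app j ⁻¹ᵁ (D.map f ⁻¹ᵁ V a) = U a := fun a => by
    rw [← hUV a]
    change (c.π.app j ⁻¹ᵁ (D.map f ⁻¹ᵁ V a) : c.pt.Opens) = c.π.app i ⁻¹ᵁ V a
    rw [← Scheme.Hom.comp_preimage, c.w]
  -- (1) `T_{aa} = 1` on the limit
  have h1 : ∀ a x y, (c.π.app j).app (D.map f ⁻¹ᵁ V a ⊓ D.map f ⁻¹ᵁ V a) (T a a x y) =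
      (c.π.app j).app (D.map f ⁻¹ᵁ V a ⊓ D.map f ⁻¹ᵁ V a)
        ((1 : Matrix (J a) (J a) Γ(D.obj j, D.map f ⁻¹ᵁ V a ⊓ D.map f ⁻¹ᵁ V a)) x y) := by
    intro a x y
    refine app_eq_app_of_appLE (c.π.app j) (by rw [Scheme.Hom.preimage_inf, hUV'])
      (hle a a) ?_
    have h := congrFun (congrFun (hT a a) x) y
    rw [Matrix.map_apply] at h
    change (c.π.app j).appLE _ (U a ⊓ U a) (hle a a) (T a a x y) = _ at h
    rw [h, Subsingleton.elim (Opens.infLERight (U a) (U a)) (Opens.infLELeft (U a) (U a)),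
      transition_self]
    have h1' := congrFun (congrFun (Matrix.map_one
      ((c.π.app j).appLE (D.map f ⁻¹ᵁ V a ⊓ D.map f ⁻¹ᵁ V a) (U a ⊓ U a) (hle a a)).hom
      (map_zero _) (map_one _)) x) y
    rw [Matrix.map_apply] at h1'
    exact h1'.symm
  obtain ⟨k₁, g₁, hk₁⟩ := exists_app_map_eq_map_of_finite D c hc (α := Σ a, J a × J a)
    (fun x => D.map f ⁻¹ᵁ V x.1 ⊓ D.map f ⁻¹ᵁ V x.1) (fun x => hV2c x.1 x.1)
    (fun x => T x.1 x.1 x.2.1 x.2.2)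
    (fun x => (1 : Matrix (J x.1) (J x.1) Γ(D.obj j, D.map f ⁻¹ᵁ V x.1 ⊓ D.map f ⁻¹ᵁ V x.1))
      x.2.1 x.2.2)
    (fun x => h1 x.1 x.2.1 x.2.2)
  -- (2) the cocycle identity on the limit
  have h2 : ∀ a b d x y, (c.π.app j).app (D.map f ⁻¹ᵁ V a ⊓ D.map f ⁻¹ᵁ V b ⊓ D.map f ⁻¹ᵁ V d)
      (((T a b).map (secRes (D.obj j) (inf_le_left :
          D.map f ⁻¹ᵁ V a ⊓ D.map f ⁻¹ᵁ V b ⊓ D.map f ⁻¹ᵁ V d ≤ _)) *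
        (T b d).map (secRes (D.obj j) (le_inf (inf_le_left.trans inf_le_right) inf_le_right :
          D.map f ⁻¹ᵁ V a ⊓ D.map f ⁻¹ᵁ V b ⊓ D.map f ⁻¹ᵁ V d ≤ _))) x y) =
      (c.π.app j).app (D.map f ⁻¹ᵁ V a ⊓ D.map f ⁻¹ᵁ V b ⊓ D.map f ⁻¹ᵁ V d)
        (((T a d).map (secRes (D.obj j) (le_inf (inf_le_left.trans inf_le_left) inf_le_right :
          D.map f ⁻¹ᵁ V a ⊓ D.map f ⁻¹ᵁ V b ⊓ D.map f ⁻¹ᵁ V d ≤ _))) x y) := by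
    intro a b d x y
    have hpre : c.π.app j ⁻¹ᵁ (D.map f ⁻¹ᵁ V a ⊓ D.map f ⁻¹ᵁ V b ⊓ D.map f ⁻¹ᵁ V d) =
        U a ⊓ U b ⊓ U d := by
      rw [Scheme.Hom.preimage_inf, Scheme.Hom.preimage_inf, hUV', hUV', hUV']
    have hle3 : U a ⊓ U b ⊓ U d ≤
        c.π.app j ⁻¹ᵁ (D.map f ⁻¹ᵁ V a ⊓ D.map f ⁻¹ᵁ V b ⊓ D.map f ⁻¹ᵁ V d) := hpre.symm.le
    refine app_eq_app_of_appLE (c.π.app j) hpre hle3 ?_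
    -- push `π_j^♯` through: every factor becomes a transition matrix of the frames
    have key : ∀ (a' b' : ι)
        (h₁ : D.map f ⁻¹ᵁ V a ⊓ D.map f ⁻¹ᵁ V b ⊓ D.map f ⁻¹ᵁ V d ≤
          D.map f ⁻¹ᵁ V a' ⊓ D.map f ⁻¹ᵁ V b')
        (h₂ : U a ⊓ U b ⊓ U d ≤ U a' ⊓ U b'),
        ((T a' b').map (secRes (D.obj j) h₁)).map
          ((c.π.app j).appLE _ (U a ⊓ U b ⊓ U d) hle3).hom =
          transition (e a') (e b') (homOfLE (h₂.trans inf_le_left))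
            (homOfLE (h₂.trans inf_le_right)) := by
      intro a' b' h₁ h₂
      rw [map_secRes_map_appLE, ← map_appLE_map_secRes (c.π.app j) h₂ (hle a' b'), hT a' b']
      change (transition (e a') (e b') _ _).map (c.pt.presheaf.map (homOfLE h₂).op).hom = _
      rw [transition_map]
      rfl
    change (Matrix.map ((T a b).map (secRes (D.obj j) (inf_le_left :
          D.map f ⁻¹ᵁ V a ⊓ D.map f ⁻¹ᵁ V b ⊓ D.map f ⁻¹ᵁ V d ≤ _)) *
        (T b d).map (secRes (D.obj j) (le_inf (inf_le_left.trans inf_le_right) inf_le_right :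
          D.map f ⁻¹ᵁ V a ⊓ D.map f ⁻¹ᵁ V b ⊓ D.map f ⁻¹ᵁ V d ≤ _)))
        ((c.π.app j).appLE _ (U a ⊓ U b ⊓ U d) hle3).hom) x y =
      (((T a d).map (secRes (D.obj j) (le_inf (inf_le_left.trans inf_le_left) inf_le_right :
          D.map f ⁻¹ᵁ V a ⊓ D.map f ⁻¹ᵁ V b ⊓ D.map f ⁻¹ᵁ V d ≤ _))).map
        ((c.π.app j).appLE _ (U a ⊓ U b ⊓ U d) hle3).hom) x y
    rw [Matrix.map_mul, key a b inf_le_left inf_le_left,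
      key b d (le_inf (inf_le_left.trans inf_le_right) inf_le_right)
        (le_inf (inf_le_left.trans inf_le_right) inf_le_right),
      key a d (le_inf (inf_le_left.trans inf_le_left) inf_le_right)
        (le_inf (inf_le_left.trans inf_le_left) inf_le_right),
      Subsingleton.elim (homOfLE ((le_inf (inf_le_left.trans inf_le_right) inf_le_right :
          U a ⊓ U b ⊓ U d ≤ U b ⊓ U d).trans inf_le_left))
        (homOfLE ((inf_le_left : U a ⊓ U b ⊓ U d ≤ U a ⊓ U b).trans inf_le_right)),
      transition_mul]
  obtain ⟨k₂, g₂, hk₂⟩ := exists_app_map_eq_map_of_finite D c hc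
    (α := Σ p : ι × ι × ι, J p.1 × J p.2.2)
    (fun x => D.map f ⁻¹ᵁ V x.1.1 ⊓ D.map f ⁻¹ᵁ V x.1.2.1 ⊓ D.map f ⁻¹ᵁ V x.1.2.2)
    (fun x => (hV2c x.1.1 x.1.2.1).inter_of_isOpen ((D.map f).isCompact_preimage (hVc x.1.2.2))
      (D.map f ⁻¹ᵁ V x.1.1 ⊓ D.map f ⁻¹ᵁ V x.1.2.1).2 (D.map f ⁻¹ᵁ V x.1.2.2).2)
    (fun x => ((T x.1.1 x.1.2.1).map (secRes (D.obj j) inf_le_left) *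
      (T x.1.2.1 x.1.2.2).map (secRes (D.obj j)
        (le_inf (inf_le_left.trans inf_le_right) inf_le_right)) :
          Matrix (J x.1.1) (J x.1.2.2)
            Γ(D.obj j, D.map f ⁻¹ᵁ V x.1.1 ⊓ D.map f ⁻¹ᵁ V x.1.2.1 ⊓ D.map f ⁻¹ᵁ V x.1.2.2))
      x.2.1 x.2.2)
    (fun x => ((T x.1.1 x.1.2.2).map (secRes (D.obj j)
      (le_inf (inf_le_left.trans inf_le_left) inf_le_right)) :
        Matrix (J x.1.1) (J x.1.2.2)
          Γ(D.obj j, D.map f ⁻¹ᵁ V x.1.1 ⊓ D.map f ⁻¹ᵁ V x.1.2.1 ⊓ D.map f ⁻¹ᵁ V x.1.2.2))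
      x.2.1 x.2.2)
    (fun x => h2 x.1.1 x.1.2.1 x.1.2.2 x.2.1 x.2.2)
  -- (3) the covering
  have htop : c.π.app j ⁻¹ᵁ (⨆ a, D.map f ⁻¹ᵁ V a) = ⊤ := by
    rw [Scheme.Hom.preimage_iSup]
    simp_rw [hUV']
    exact hUtop
  obtain ⟨k₃, g₃, hk₃⟩ := exists_map_eq_top D c hc (⨆ a, D.map f ⁻¹ᵁ V a) htop
  -- one common arrow `g : k ⟶ j`
  obtain ⟨l₁, m₁, m₂, hl₁⟩ := IsCofiltered.cospan g₁ g₂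
  obtain ⟨k, m, m₃, hk⟩ := IsCofiltered.cospan (m₁ ≫ g₁) g₃
  have e1 : ∀ a x y, (D.map (m ≫ m₁ ≫ g₁)).app _ (T a a x y) = (D.map (m ≫ m₁ ≫ g₁)).app _
      ((1 : Matrix (J a) (J a) Γ(D.obj j, D.map f ⁻¹ᵁ V a ⊓ D.map f ⁻¹ᵁ V a)) x y) :=
    fun a x y => by
    rw [← Category.assoc]
    exact app_eq_app_of_comp D g₁ (m ≫ m₁) (hk₁ ⟨a, (x, y)⟩)
  have e2 := fun a b d x y => by
    have h := app_eq_app_of_comp D g₂ (m ≫ m₂) (hk₂ ⟨(a, b, d), (x, y)⟩)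
    rw [Category.assoc, ← hl₁] at h
    exact h
  have e3 : D.map (m ≫ m₁ ≫ g₁) ⁻¹ᵁ (⨆ a, D.map f ⁻¹ᵁ V a) = ⊤ := by
    rw [hk, Functor.map_comp, Scheme.Hom.comp_preimage, hk₃]
    rfl
  -- conclusion, with `g := m ≫ m₁ ≫ g₁`
  set g := m ≫ m₁ ≫ g₁ with hg
  clear_value g
  have hW : ∀ a b, D.map g ⁻¹ᵁ (D.map f ⁻¹ᵁ V a) ⊓ D.map g ⁻¹ᵁ (D.map f ⁻¹ᵁ V b) ≤
      D.map g ⁻¹ᵁ (D.map f ⁻¹ᵁ V a ⊓ D.map f ⁻¹ᵁ V b) := fun a b =>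
    (Scheme.Hom.preimage_inf (D.map g)).symm.le
  refine ⟨k, g, hW, fun a => ?_, fun a b d => ?_, ?_⟩
  · -- `G_{aa} = 1`
    ext x y
    rw [Matrix.map_apply]
    change (D.map g).appLE _ _ (hW a a) (T a a x y) = _
    rw [appLE_eq_of_app_eq (D.map g) (hW a a) (e1 a x y), Matrix.one_apply, Matrix.one_apply]
    split_ifs <;> simp
  · -- the cocycle identity
    have h3 : D.map g ⁻¹ᵁ (D.map f ⁻¹ᵁ V a) ⊓ D.map g ⁻¹ᵁ (D.map f ⁻¹ᵁ V b) ⊓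
        D.map g ⁻¹ᵁ (D.map f ⁻¹ᵁ V d) ≤
        D.map g ⁻¹ᵁ (D.map f ⁻¹ᵁ V a ⊓ D.map f ⁻¹ᵁ V b ⊓ D.map f ⁻¹ᵁ V d) := by
      rw [Scheme.Hom.preimage_inf, Scheme.Hom.preimage_inf]
    have key : Matrix.map ((T a b).map (secRes (D.obj j) (inf_le_left :
          D.map f ⁻¹ᵁ V a ⊓ D.map f ⁻¹ᵁ V b ⊓ D.map f ⁻¹ᵁ V d ≤ _)) *
        (T b d).map (secRes (D.obj j) (le_inf (inf_le_left.trans inf_le_right) inf_le_right :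
          D.map f ⁻¹ᵁ V a ⊓ D.map f ⁻¹ᵁ V b ⊓ D.map f ⁻¹ᵁ V d ≤ _)))
          ((D.map g).appLE _ _ h3).hom =
        ((T a d).map (secRes (D.obj j) (le_inf (inf_le_left.trans inf_le_left) inf_le_right :
          D.map f ⁻¹ᵁ V a ⊓ D.map f ⁻¹ᵁ V b ⊓ D.map f ⁻¹ᵁ V d ≤ _))).map
          ((D.map g).appLE _ _ h3).hom := by
      ext x y
      rw [Matrix.map_apply, Matrix.map_apply]
      exact appLE_eq_of_app_eq (D.map g) h3 (e2 a b d x y)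
    rw [Matrix.map_mul, map_secRes_map_appLE, map_secRes_map_appLE, map_secRes_map_appLE] at key
    rw [map_appLE_map_secRes, map_appLE_map_secRes, map_appLE_map_secRes]
    exact key
  · rw [← Scheme.Hom.preimage_iSup]
    exact e3

end FiniteLocallyFreeDescent

end Literature.AlgebraicGeometry.Limits
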